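import Mathlib
import HarnessLib
import Summits.KontsevichZagierPeriods.KontsevichZagierPeriods.Theses.RootDecompWalshStrata

/-!
# Route D `RootDecompWalshStrata` — the rung `d ≤ 3` of the quadric stratum rests on Baker

Kernel-checked edges between the route's items (lens decomp-kz-lens-4, gen 3; texts of the items are
the route file's, cited BY NAME):

* `quadricThree_of_quadricSignKernel : QuadricSignKernel → QuadricThree` (the rung is WEAKER than
  the stratum piece — specialisation to `dᵢ ≤ 3`);
* `quadricThree_of_bakerKernel_of_bakerDescent : BakerKernel → QuadricBakerDescent → QuadricThree`,
  where the Baker kernel hypothesis is stated VERBATIM as the type of the tree theorem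
  `Summit.KontsevichZagierPeriods.HurwitzMicroSectors.NormalFormPrinciple.PiBox.Dlog.mem_relations_of_eval_eq_zero_of_dim_le_one`
  (Theorems/HurwitzMicroSectorsNormalFormPrincipleDimOneAssembly.lean; input `baker_holds`,
  Baker 1975 Thm 2.1). It is kept as a HYPOTHESIS here only because that module's import closure is
  not built on the farm today; discharging it is `fun hD => quadricThree_of_bakerKernel_of_bakerDescent
  (fun _ hx hv => mem_relations_of_eval_eq_zero_of_dim_le_one hx hv) hD` once it builds.

So the support item `QuadricThree` (stmt-KontsevichZagierPeriods-27596) closes as soon as the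
moves-only leaf `QuadricBakerDescent` (stmt-KontsevichZagierPeriods-27597) does. 0 sorry.
[KontsevichZagier2001 §1.2; Baker1975 Thm 2.1]
-/

namespace Summit.KontsevichZagierPeriods.RootDecompWalshStrata.QuadricRung

open Literature.NumberTheory.Transcendental
open Summit.KontsevichZagierPeriods.KontsevichZagierPeriods.Theses.RootDecompWalshStrata
  (QuadricSignKernel QuadricThree QuadricBakerDescent)

/-- The rung `d ≤ 3` is a specialisation of the quadric-stratum piece:
`QuadricSignKernel → QuadricThree`. [KontsevichZagier2001 §1.2] -/
theorem quadricThree_of_quadricSignKernel (hQ : QuadricSignKernel) : QuadricThree :=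
  fun k d P q ρ c hρ hdeg _ hv => hQ k d P q ρ c hρ hdeg hv

/-- **`BakerKernel → QuadricBakerDescent → QuadricThree`.** Descend each cell of a vanishing
`ℤ`-combination into the Baker sector (`hD`); the descended combination has value `0` because
relations evaluate to `0` (`KZ.relations_le_ker_eval_holds`), hence is a relation by the Baker kernel
(`hB`, the type of the tree theorem `PiBox.Dlog.mem_relations_of_eval_eq_zero_of_dim_le_one`), and the
original combination differs from it by relations. [Baker1975 Thm 2.1; KontsevichZagier2001 §1.2] -/
theorem quadricThree_of_bakerKernel_of_bakerDescent
    (hB : ∀ ⦃x : KZ.FormalRep⦄, x ∈ AddSubgroup.closure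
        {y : KZ.FormalRep | ∃ (m : ℕ) (N : KZ.IntegralRep m), m ≤ 1 ∧ N.IsRational ∧ y = KZ.of N} →
      KZ.eval x = 0 → x ∈ KZ.relations)
    (hD : QuadricBakerDescent) : QuadricThree := by
  intro k d P q ρ c hρ hdeg hd hv
  choose y hy hrel using fun i => hD (d i) (P i) (q i) (ρ i) (hρ i) (hdeg i) (hd i)
  have h1 : (∑ i, c i • KZ.of (ρ i)) - ∑ i, c i • y i ∈ KZ.relations := by
    rw [← Finset.sum_sub_distrib]
    exact AddSubgroup.sum_mem _ fun i _ => by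
      rw [← smul_sub]; exact AddSubgroup.zsmul_mem _ (hrel i) _
  have h2 : (∑ i, c i • y i) ∈ AddSubgroup.closure
      {y : KZ.FormalRep | ∃ (m : ℕ) (N : KZ.IntegralRep m), m ≤ 1 ∧ N.IsRational ∧ y = KZ.of N} :=
    AddSubgroup.sum_mem _ fun i _ => AddSubgroup.zsmul_mem _ (hy i) _
  have h3 : KZ.eval (∑ i, c i • y i) = 0 := by
    have h := KZ.relations_le_ker_eval_holds h1
    rw [AddMonoidHom.mem_ker, map_sub, hv, zero_sub, neg_eq_zero] at h
    exact h
  have h4 := hB h2 h3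
  have := KZ.relations.add_mem h1 h4
  simpa using this

/-- Corollary: modulo the Baker kernel, the two open support items are equivalent in strength as far
as the rung is concerned — `QuadricBakerDescent` ALONE carries `QuadricThree`; and the summit piece
`QuadricSignKernel` gives the rung outright. Packaged as an `↔`-free pair for the dossier. -/
theorem quadricThree_of_bakerDescent_or_signKernel
    (hB : ∀ ⦃x : KZ.FormalRep⦄, x ∈ AddSubgroup.closure
        {y : KZ.FormalRep | ∃ (m : ℕ) (N : KZ.IntegralRep m), m ≤ 1 ∧ N.IsRational ∧ y = KZ.of N} →
      KZ.eval x = 0 → x ∈ KZ.relations)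
    (h : QuadricBakerDescent ∨ QuadricSignKernel) : QuadricThree :=
  h.elim (quadricThree_of_bakerKernel_of_bakerDescent hB) quadricThree_of_quadricSignKernel

end Summit.KontsevichZagierPeriods.RootDecompWalshStrata.QuadricRung
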